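import Literature.MathematicalPhysics.QuantumFieldTheory.Balaban1983to89.T3SectALandauChart
import Literature.MathematicalPhysics.QuantumFieldTheory.Balaban1983to89.BlockAveragingEMLLinearisedBackground
import HarnessLib

/-!
# Route `UnitScaleTilt`, crux K1 child «MinimiserStabilityRegPr» (stmt-QuantumFields-19200), registered stub `stub_prop7From14` (skeleton birth_v5
# 98cb23610ad7; leaf V3 «Prop 7 from a background (14)») — THE UNIQUENESS CLAUSE OF [Balaban1985Variational] PROP. 7 AT THE d = 3 CARRIER
# (reading R2 of `T3Thm1Carrier`, first conjunct of `T3Thm1CarrierNative.Prop7From14NativeAt`) REDUCED TO TWO LOCAL STATEMENTS: a gauge CHART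
# inside print's group (4), and STRICT GROWTH of the Wilson action at a critical configuration along its chart — no contraction, no sup-norm
# Green's functions

Cell `ym3-torus` ∕ fleet seat `ym-ust-19200-p1` (gen 3; HUMAN RULING D-0037, YM ladder rung R3).  WHERE THIS SITS.  Print proves «the variational
problem (5), (6) has at most one critical orbit» (Prop. 7 p. 299) through Prop. 2 (every critical orbit has a representative in the Landau chart
(19)–(21) about the background, by [Balaban1985RegularSpaces] Thm 2), the linearising transformation (47), and the CONTRACTION of Props 5–6 for
Eq. (111) in the weighted sup norms (115) — which needs the decay of the Green's functions `G₁, 𝔊` ([Balaban1985BackgroundPropagators] Thms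
3.12–3.13, leaf V3-D3 of the item's split card, XL).  The item's `ℓ²` engine (p473711–p483802: [Balaban1985BackgroundPropagators] Thm 3.11 in `L²`
form at a small-field background and the quadratic growth `A(U) − A(U₀) − Lin_{U₀}(U) ≥ cL^{−2(K−n)}Σ‖Y‖²` on the covariant slice, `k`-uniform,
absolute constants) suggests a shorter road to the UNIQUENESS clause, recorded here as a kernel-checked reduction: if every pair of critical
configurations is related by a chart inside the group (4), and the action grows strictly at each critical configuration along its chart, then two
critical configurations have `A(U) ≤ A(U′) ≤ A(U)`, the growth at `U′` is an equality, and `U′` is a gauge transform of `U` — the existence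
clause (a minimiser INSIDE the open space (6)(O(1)C₁B₃ε₁)) is where sup-norm control stays indispensable.

RELATION TO THE TREE.  Print's own route is knit at the carrier by `T3SectALandauChart.prop7From14At_of_props` (lit-balaban-type-B11: V3 ⇐
Props 2, 5, 6 + located laws, BY NAME); this file records the ALTERNATIVE route for the uniqueness half that the `ℓ²` engine can feed, and uses
that module's group-(4) bookkeeping (`isCritR2_gaugeAct_of_trivial`, `T3PrintedRegularOrbits.gaugeAct_mem_regFibrePr_iff_of_trivial`).

WHAT IS PROVED HERE (sorry-free, no definition; the chart relation `Gauge` is a free parameter, the two hypotheses are displayed ∀-statements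
at the carrier's objects; nothing of Bałaban's is asserted).
* §1 **`sameOrbit_of_chart_of_strictGrowth`** / **`atMostOneCriticalOrbit_of_chart_of_strictGrowth`**: for `ε₀ ≥ 0`, a datum `V`, any
  `Gauge : Cfg → Cfg → Prop`, (chart) `∀` critical `U, U′ ∈ (6)(ε₀) ∩ fibre(V), ∃ u, u↓ = 1 ∧ Gauge U (U′^u)`, (growth) `∀` critical `U, W ∈
  (6)(ε₀) ∩ fibre(V)` with `Gauge U W`: `A(U) ≤ A(W) ∧ (A(W) = A(U) → W = U)` ⟹ the first conjunct of `Prop7From14NativeAt` at `(V, ε₀)`: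
  any two reading-R2 critical `U, U′` with `RegPr ε₀`, in `fibre(V)`, satisfy `T3Thm1Carrier.SameOrbit U U′`.
* §2 `eq_of_pertVar_eq_zero` (`Y ≡ 0 ⇒ W = U`, `Y_b = W_bU_b⁻¹ − 1` = `BlockAveragingEMLLinearisedBackground.pertVar`), `strictGrowth_of_quadratic`
  (`κΣ_b‖Y_b‖² ≤ A(W) − A(U)`, `κ > 0` ⇒ strict growth), **`atMostOneCriticalOrbit_of_chart_of_quadraticGrowth`** (the reduction with the growth
  hypothesis in the `ℓ²` engine's currency).

HOW THE TWO HYPOTHESES ARE MEANT TO BE DISCHARGED (not here).  Chart = [Balaban1985RegularSpaces] Thm 2 at the carrier about a CRITICAL `U ∈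
(6)(ε₀)` (its regularity (3.35) is what Sect. F gives critical configurations; typed schema `B8Thm2TorusAt` p465891 / `B8Thm2SetupTorus`), `Gauge U W`
:= «`Y = WU⁻¹ − 1` sup-small with its covariant gradient, in the chart's Landau-type gauge».  Growth = the engine's expansion at the background `U`
(p482559/p483802) with the linear term `Lin_U(Y)` controlled by criticality: `Lin_U` vanishes on the tangent space of the fibre and the secant `Y` is
tangent up to `H·Taylor₂`, `H` a right inverse of the linearised averaging with `k`-uniform `ℓ¹` bound (this seat's `…LineAvgRightInverse`), against
the divergence clause of (6) (`‖D^*_UF_U‖_∞ < ε₀L^{−3(K−n)}`) — volume-free; plus the identification of the averaging constraint (V3-D1c).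

References: T. Bałaban, CMP 102 (1985) 277–309 [Balaban1985Variational] ((4)–(6), (15) p.278–280, Prop. 2 p.281, Props 5–7 pp.294–299,
(141)–(143) p.299); CMP 99 (1985) 75–102 [Balaban1985RegularSpaces] (Thm 2 p.83); CMP 99 (1985) 389–434 [Balaban1985BackgroundPropagators]
(Thms 3.11–3.13 pp.416–426).
-/

noncomputable section

open scoped BigOperators Matrix.Norms.L2Operator

namespace Summit.QuantumFields.YangMills.Theorems.Prop7UniquenessReduction

open Literature.MathematicalPhysics.QuantumFieldTheory.Balaban1983to89
open T3ContinuumYM3Torus T3ConstrainedMinimiser T3PrintedRegularMinimiser T3Thm1CarrierNative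
open T3UnitLawDensityEML (ℰp)
open T3PrintedRegularOrbits (descTransf gaugeAct_mem_regFibrePr_iff_of_trivial)
open BlockAveragingEMLLinearisedBackground (pertVar pertVar_eq)

variable (F : T3Family) (n K : ℕ) (h : n ≤ K)

/-! ## §1 The reduction: chart + strict growth ⇒ at most one critical orbit -/

/-- **AT MOST ONE CRITICAL ORBIT FROM A CHART AND STRICT GROWTH** (the uniqueness clause of [Balaban1985Variational] Prop. 7 p. 299 at the
d = 3 carrier, reading R2, reduced): let `Gauge U W` be ANY relation («`W` is in chart gauge about `U`»).  Suppose (chart) any two reading-R2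
critical configurations `U, U′ ∈ (6)(ε₀) ∩ fibre(V)` admit `u` in the group (4) (`u↓ = 1`) with `Gauge U (U′^u)`, and (strict growth) for
critical `U, W ∈ (6)(ε₀) ∩ fibre(V)` with `Gauge U W`: `A(U) ≤ A(W)`, with equality only if `W = U`.  Then `U` and `U′` lie on one orbit of
the group (4) (`T3Thm1Carrier.SameOrbit`).  Mechanism: `A(U) ≤ A(U′^u) = A(U′) ≤ A(U^{u′}) = A(U)`, so the growth at `U′` is an equality and
`U^{u′} = U′`.  Print obtains uniqueness through the contraction of Props 5–6 in weighted sup norms; here only the chart (Prop. 2 / [6] Thm 2)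
and a LOCAL strict-minimality statement are consumed. [cite: Balaban1985Variational, Prop 7 p.299] -/
theorem sameOrbit_of_chart_of_strictGrowth {ε₀ : ℝ} (hε : 0 ≤ ε₀)
    (V : GaugeField (F.P n) 0 (Matrix.specialUnitaryGroup (Fin 2) ℂ))
    (Gauge : GaugeField (F.P K) 0 (Matrix.specialUnitaryGroup (Fin 2) ℂ) → GaugeField (F.P K) 0 (Matrix.specialUnitaryGroup (Fin 2) ℂ) → Prop)
    (hchart : ∀ U U' : GaugeField (F.P K) 0 (Matrix.specialUnitaryGroup (Fin 2) ℂ),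
      U ∈ regFibrePr F n K h ε₀ V → IsCritR2 F n K h V U → U' ∈ regFibrePr F n K h ε₀ V → IsCritR2 F n K h V U' →
        ∃ u : GaugeTransf (F.P K) 0 (Matrix.specialUnitaryGroup (Fin 2) ℂ),
          descTransf F n K h u = (fun _ => 1) ∧ Gauge U (GaugeField.gaugeAct u U'))
    (hgrowth : ∀ U W : GaugeField (F.P K) 0 (Matrix.specialUnitaryGroup (Fin 2) ℂ),
      U ∈ regFibrePr F n K h ε₀ V → IsCritR2 F n K h V U → W ∈ regFibrePr F n K h ε₀ V → IsCritR2 F n K h V W → Gauge U W →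
        wilsonAction4 U ≤ wilsonAction4 W ∧ (wilsonAction4 W = wilsonAction4 U → W = U))
    {U U' : GaugeField (F.P K) 0 (Matrix.specialUnitaryGroup (Fin 2) ℂ)}
    (hU : U ∈ regFibrePr F n K h ε₀ V) (hcU : IsCritR2 F n K h V U) (hU' : U' ∈ regFibrePr F n K h ε₀ V) (hcU' : IsCritR2 F n K h V U') :
    T3Thm1Carrier.SameOrbit F n K h U U' := by
  -- chart of `U′` about `U`, chart of `U` about `U′`
  obtain ⟨u, hu, hG⟩ := hchart U U' hU hcU hU' hcU'
  obtain ⟨u', hu', hG'⟩ := hchart U' U hU' hcU' hU hcU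
  have hWu : GaugeField.gaugeAct u U' ∈ regFibrePr F n K h ε₀ V := (gaugeAct_mem_regFibrePr_iff_of_trivial F h hε hu U' V).mpr hU'
  have hWu' : GaugeField.gaugeAct u' U ∈ regFibrePr F n K h ε₀ V := (gaugeAct_mem_regFibrePr_iff_of_trivial F h hε hu' U V).mpr hU
  have hcWu : IsCritR2 F n K h V (GaugeField.gaugeAct u U') := T3SectALandauChart.isCritR2_gaugeAct_of_trivial F h hu hcU'
  have hcWu' : IsCritR2 F n K h V (GaugeField.gaugeAct u' U) := T3SectALandauChart.isCritR2_gaugeAct_of_trivial F h hu' hcU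
  have hA : wilsonAction4 (GaugeField.gaugeAct u U') = wilsonAction4 U' := T4WilsonGaugeFlatDirection.wilsonAction_gaugeAct 1 u U'
  have hA' : wilsonAction4 (GaugeField.gaugeAct u' U) = wilsonAction4 U := T4WilsonGaugeFlatDirection.wilsonAction_gaugeAct 1 u' U
  obtain ⟨h1, -⟩ := hgrowth U _ hU hcU hWu hcWu hG
  obtain ⟨h2, h2eq⟩ := hgrowth U' _ hU' hcU' hWu' hcWu' hG'
  rw [hA] at h1
  rw [hA'] at h2
  have heq : wilsonAction4 (GaugeField.gaugeAct u' U) = wilsonAction4 U' := by rw [hA']; exact le_antisymm h1 h2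
  exact ⟨u', hu', (h2eq heq).symm⟩

/-- **THE UNIQUENESS CLAUSE OF PROP. 7 AT THE CARRIER, IN THE SHAPE OF `T3Thm1CarrierNative.Prop7From14NativeAt`** (first conjunct, at a
datum `V` and radius `ε₀ ≥ 0`), from the chart and the strict growth: for all `U, U′` with `RegPr ε₀`, in the (0.4)-fibre of `V`, critical in
reading R2 — `SameOrbit U U′`. [cite: Balaban1985Variational, Prop 7 p.299] -/
theorem atMostOneCriticalOrbit_of_chart_of_strictGrowth {ε₀ : ℝ} (hε : 0 ≤ ε₀)
    (V : GaugeField (F.P n) 0 (Matrix.specialUnitaryGroup (Fin 2) ℂ))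
    (Gauge : GaugeField (F.P K) 0 (Matrix.specialUnitaryGroup (Fin 2) ℂ) → GaugeField (F.P K) 0 (Matrix.specialUnitaryGroup (Fin 2) ℂ) → Prop)
    (hchart : ∀ U U' : GaugeField (F.P K) 0 (Matrix.specialUnitaryGroup (Fin 2) ℂ),
      U ∈ regFibrePr F n K h ε₀ V → IsCritR2 F n K h V U → U' ∈ regFibrePr F n K h ε₀ V → IsCritR2 F n K h V U' →
        ∃ u : GaugeTransf (F.P K) 0 (Matrix.specialUnitaryGroup (Fin 2) ℂ),
          descTransf F n K h u = (fun _ => 1) ∧ Gauge U (GaugeField.gaugeAct u U'))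
    (hgrowth : ∀ U W : GaugeField (F.P K) 0 (Matrix.specialUnitaryGroup (Fin 2) ℂ),
      U ∈ regFibrePr F n K h ε₀ V → IsCritR2 F n K h V U → W ∈ regFibrePr F n K h ε₀ V → IsCritR2 F n K h V W → Gauge U W →
        wilsonAction4 U ≤ wilsonAction4 W ∧ (wilsonAction4 W = wilsonAction4 U → W = U)) :
    ∀ U U' : GaugeField (F.P K) 0 (Matrix.specialUnitaryGroup (Fin 2) ℂ),
      RegPr F n K ε₀ U → U ∈ fibre F ℰp n K h V → IsCritR2 F n K h V U →
      RegPr F n K ε₀ U' → U' ∈ fibre F ℰp n K h V → IsCritR2 F n K h V U' →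
        T3Thm1Carrier.SameOrbit F n K h U U' := by
  intro U U' hrU hfU hcU hrU' hfU' hcU'
  exact sameOrbit_of_chart_of_strictGrowth F n K h hε V Gauge hchart hgrowth
    ((mem_regFibrePr_iff F).mpr ⟨hfU, hrU⟩) hcU ((mem_regFibrePr_iff F).mpr ⟨hfU', hrU'⟩) hcU'

/-! ## §2 Quantitative growth (the `ℓ²` engine's currency) gives strict growth -/

/-- A configuration with vanishing perturbation variables `Y_b = W_bU_b⁻¹ − 1 = 0` ([Balaban1985Variational] (15)) IS the background.
[cite: Balaban1985Variational, (15) p.280] -/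
theorem eq_of_pertVar_eq_zero {P : Params} {j : ℕ} (U W : GaugeField P j (Matrix.specialUnitaryGroup (Fin 2) ℂ))
    (hY : ∀ b : PBond P j, pertVar U W b = 0) : W = U := by
  funext b
  have hb := hY b
  unfold pertVar at hb
  rw [sub_eq_zero] at hb
  have hmul : W b * (U b)⁻¹ = 1 := Subtype.ext hb
  exact mul_inv_eq_one.mp hmul

/-- **QUADRATIC GROWTH IN THE `ℓ²` CURRENCY IMPLIES STRICT GROWTH**: if along the chart gauge of a critical `U` the action grows at least like
`κ·Σ_b ‖W_bU_b⁻¹ − 1‖²` with `κ > 0` (the shape produced by the item's `ℓ²` engine, `Prop7CovariantCoercivity.wilsonAction4_sub_background_ge_T3`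
with the linear term removed by criticality), then `A(U) ≤ A(W)` with equality only at `W = U`. [cite: Balaban1985Variational, (141)-(143) p.299] -/
theorem strictGrowth_of_quadratic {P : Params} {j : ℕ} {κ : ℝ} (hκ : 0 < κ)
    (U W : GaugeField P j (Matrix.specialUnitaryGroup (Fin 2) ℂ))
    (hq : κ * ∑ b : PBond P j, ‖pertVar U W b‖ ^ 2 ≤ wilsonAction4 W - wilsonAction4 U) :
    wilsonAction4 U ≤ wilsonAction4 W ∧ (wilsonAction4 W = wilsonAction4 U → W = U) := by
  have hS : 0 ≤ ∑ b : PBond P j, ‖pertVar U W b‖ ^ 2 := Finset.sum_nonneg fun b _ => sq_nonneg _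
  refine ⟨by nlinarith, fun heq => ?_⟩
  have hzero : ∑ b : PBond P j, ‖pertVar U W b‖ ^ 2 = 0 := by
    have : κ * ∑ b : PBond P j, ‖pertVar U W b‖ ^ 2 ≤ 0 := by rw [heq, sub_self] at hq; exact hq
    nlinarith
  have hall := (Finset.sum_eq_zero_iff_of_nonneg fun b _ => sq_nonneg (‖pertVar U W b‖)).mp hzero
  exact eq_of_pertVar_eq_zero U W fun b => by
    have := hall b (Finset.mem_univ b)
    rwa [sq_eq_zero_iff, norm_eq_zero] at this

/-- **THE UNIQUENESS CLAUSE FROM A CHART AND QUADRATIC `ℓ²` GROWTH AT CRITICAL CONFIGURATIONS**: with any chart relation `Gauge`, the chart inside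
the group (4) for pairs of critical configurations of `(6)(ε₀) ∩ fibre(V)`, and the growth `κ·Σ_b‖W_bU_b⁻¹ − 1‖² ≤ A(W) − A(U)` (`κ > 0`,
possibly depending on everything) for critical `U, W` in mutual chart gauge — any two reading-R2 critical configurations in `(6)(ε₀) ∩ fibre(V)`
lie on one orbit. [cite: Balaban1985Variational, Prop 7 p.299] -/
theorem atMostOneCriticalOrbit_of_chart_of_quadraticGrowth {ε₀ : ℝ} (hε : 0 ≤ ε₀)
    (V : GaugeField (F.P n) 0 (Matrix.specialUnitaryGroup (Fin 2) ℂ))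
    (Gauge : GaugeField (F.P K) 0 (Matrix.specialUnitaryGroup (Fin 2) ℂ) → GaugeField (F.P K) 0 (Matrix.specialUnitaryGroup (Fin 2) ℂ) → Prop)
    (hchart : ∀ U U' : GaugeField (F.P K) 0 (Matrix.specialUnitaryGroup (Fin 2) ℂ),
      U ∈ regFibrePr F n K h ε₀ V → IsCritR2 F n K h V U → U' ∈ regFibrePr F n K h ε₀ V → IsCritR2 F n K h V U' →
        ∃ u : GaugeTransf (F.P K) 0 (Matrix.specialUnitaryGroup (Fin 2) ℂ),
          descTransf F n K h u = (fun _ => 1) ∧ Gauge U (GaugeField.gaugeAct u U'))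
    (hgrowth : ∀ U W : GaugeField (F.P K) 0 (Matrix.specialUnitaryGroup (Fin 2) ℂ),
      U ∈ regFibrePr F n K h ε₀ V → IsCritR2 F n K h V U → W ∈ regFibrePr F n K h ε₀ V → IsCritR2 F n K h V W → Gauge U W →
        ∃ κ : ℝ, 0 < κ ∧ κ * ∑ b : PBond (F.P K) 0, ‖pertVar U W b‖ ^ 2 ≤ wilsonAction4 W - wilsonAction4 U) :
    ∀ U U' : GaugeField (F.P K) 0 (Matrix.specialUnitaryGroup (Fin 2) ℂ),
      RegPr F n K ε₀ U → U ∈ fibre F ℰp n K h V → IsCritR2 F n K h V U →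
      RegPr F n K ε₀ U' → U' ∈ fibre F ℰp n K h V → IsCritR2 F n K h V U' →
        T3Thm1Carrier.SameOrbit F n K h U U' :=
  atMostOneCriticalOrbit_of_chart_of_strictGrowth F n K h hε V Gauge hchart fun U W hU hcU hW hcW hG => by
    obtain ⟨κ, hκ, hq⟩ := hgrowth U W hU hcU hW hcW hG
    exact strictGrowth_of_quadratic hκ U W hq

end Summit.QuantumFields.YangMills.Theorems.Prop7UniquenessReduction

end
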